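import Summits.QuantumFields.YangMills.Theorems.UnitScaleTiltProp7Growth142T3ChartELStat
import Summits.QuantumFields.YangMills.Theorems.UnitScaleTiltProp7SymAvgGLSmallOfRegPr
import Summits.QuantumFields.YangMills.Theorems.UnitScaleTiltProp7CritEL
import Summits.QuantumFields.YangMills.Theorems.UnitScaleTiltProp7SymAvgRelDiffT3
import HarnessLib

/-!
# Route `UnitScaleTilt`, crux K1 child «MinimiserStabilityRegPr» (stmt-QuantumFields-19200), skeleton v10, stub `stub_existenceMinimalOrbit` (EX), route (α) — **THE KNIT'S
# E–L CLAUSE (CURVE FORM, AT EVERY GAUGE COPY) FROM PRINT'S TANGENT FORM (82)–(83) AT A REGULAR CONFIGURATION** (knit lineage LOCATE «hXtw‴ SPLIT» (iii), 2026-08-28; the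
# CONVERSE direction of `Node00.CriticalOnFibreTangent`, which needs no implicit function and no gauge lift: a bondwise-differentiable curve INSIDE a fibre has its velocity in
# the kernel of the linearised averaging, by the chain rule).

Cell `ym3-torus`, width seat `ym-ust-19200-w2` (gen 4; EX knit lineage).  THEOREMS ONLY (0 `def`, 0 `sorry`).  `--supports stmt-QuantumFields-19200 --as helper`,
count-neutral.  YM₃ on T³ is a ladder rung (R3), not the Clay problem; nothing here claims the stub, the crux, d = 4 or the mass gap.

THE PRINT.  [Balaban1985Variational] p. 290 (82)–(83): «the equation ⟨(δ∕δA′)𝔉(A′), δA′⟩ = 0 (82) holds for all δA′ in the tangent space, that is δA′ satisfying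
QδA′ = 0, RD*δA′ = 0 (83)»; p. 299 (141); p. 278 (3)–(5) (the fibres `𝔅_k(V)` and the gauge invariance of (5)); [Balaban1985Averaging] (11) p. 19 (covariance of the
averages: `(U^u)‾ = Ū^{u↓}`).  The EX knit's last XL row `hXtw‴` asks, in its third conjunct, for the CURVE form of criticality («`deriv (A ∘ γ) 0 = 0` along every
bondwise-differentiable curve `γ` in `𝔅_k(V)` through `W = (e^{iX}U₀)^u`»); print works with the TANGENT form at the chart point.  This file is the junction.

WHAT IS PROVED (sorry-free, no definition).  ★★★ **`fibreEL_of_tangentCritical`** — at one member: let `U′ ∈ 𝔘_k(ε₀)` (`10⁷L³ε₀ ≤ 1`), let the RELATIVE AVERAGE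
`A ↦ D̄(e^{A}U′)·D̄(U′)⁻¹` (the letter of ✓`Prop7SymAvgTwSymBridge.hasFDerivAt_logChartTwS`'s `hG`, i.e. `QSym_{U′}`) have derivative `G′` at `0`, and let `U′` be
TANGENT-CRITICAL: `Lin_{U′}(ξ) = 0` for every `ξ ∈ ker G′` (`Lin` = the first-variation letter of ✓`Prop7Growth142T3ChartELStat` ∕ ✓`Prop8Criticality`).  Then EVERY gauge copy
`W = U′^u` satisfies the knit's E–L clause: along every curve `γ` with `γ 0 = W`, `γ t ∈ 𝔅_k(V)` for all `t`, bondwise differentiable at `0`, `deriv (A ∘ γ) 0 = 0`.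
PROOF BY NAME: `γ̃ := γ^{u⁻¹}` has `A ∘ γ = A ∘ γ̃` (✓`wilsonAction_gaugeAct`), `γ̃ 0 = U′`, and lies in ONE fibre (✓`gaugeAct_mem_fibre_iff`); it is eventually
`𝔘_k(ε₀)`-regular (✓`isOpen_regPr`), so its `(M₂)ˣ`-average is constant (✓`descendToGL_eq_of_mem_fibre_of_regPr`); in the log-coordinates `A(t)(b) = log(γ̃(t)(b)·U′(b)^*)`
(✓`exp_mlog`, ✓`hasFDerivAt_mlog_one`) the relative average is therefore eventually `1`, so its derivative `G′ξ` (chain rule with `hG`; `ξ` = the bond velocities) vanishes;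
tangent-criticality gives `Lin_{U′}(ξ) = 0`, and ✓`hasDerivAt_wilsonAction4_of_hasDerivAt_mulStar` identifies `Lin_{U′}(ξ)` with `deriv (A ∘ γ̃) 0`.  §2 ★★★
**`fibreEL_of_tangentCritical_QSym`** — the same with `hG` DISCHARGED at printed-regular backgrounds (✓`hasFDerivAt_rel_of_regPr`) and the tangent space read as
`ker QSym(U′)` (✓`hasFDerivAt_logChartSym`): the form the next knit version can display in place of `hXtw‴`'s third conjunct.
HONEST SCOPE: carrier-side calculus over landed theorems; the tangent-criticality of the chart point (print's (141) in `QSym`-letters) is a HYPOTHESIS here — it is what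
[Balaban1985Variational] Sect. C ((93) ⇔ (111)) and the restricted-gauge decomposition must deliver; nothing of print is asserted.

References: T. Bałaban, CMP 102 (1985) 277–309 [Balaban1985Variational] ((82)–(83) p.290, (141) p.299, (3)–(5) p.278, (26)–(27) p.282); CMP 98 (1985) 17–51
[Balaban1985Averaging] ((11) p.19); CMP 109 (1987) 249–301 [Balaban1987RG1] ((0.4) p.253).
-/

set_option autoImplicit false

noncomputable section

open scoped BigOperators Matrix.Norms.L2Operator Matrix Topology
open Filter

namespace Summit.QuantumFields.YangMills.Theorems.Prop7FibreELOfTangentCritical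

open NormedSpace
open Literature.MathematicalPhysics.QuantumFieldTheory.Balaban1983to89
open Literature.MathematicalPhysics.QuantumFieldTheory.Balaban1983to89.T3ContinuumYM3Torus
open Literature.MathematicalPhysics.QuantumFieldTheory.Balaban1983to89.T3UnitLawDensityEML (ℰp)
open Literature.MathematicalPhysics.QuantumFieldTheory.Balaban1983to89.T3ConstrainedMinimiser (fibre)
open Literature.MathematicalPhysics.QuantumFieldTheory.Balaban1983to89.T3PrintedRegularMinimiser (RegPr)
open Literature.MathematicalPhysics.QuantumFieldTheory.Balaban1983to89.T3PrintedRegularOrbits (descTransf gaugeAct_mem_fibre_iff)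
open Literature.MathematicalPhysics.QuantumFieldTheory.Balaban1983to89.T3SectALandauChart (bgUnits)
open B7Prop1Explicit (expUnit val_expUnit)
open B10Eq27TorusAxialLog (unitsField toUField)
open MatrixLog (mlog mlog_one exp_mlog)
open B7TransferAnalyticMean (hasFDerivAt_mlog_one)
open Summit.QuantumFields.YangMills.Theorems.Prop7SymAvgGL (descendToGL)
open Summit.QuantumFields.YangMills.Theorems.Prop7SymAvgGLSmallOfRegPr (descendToGL_eq_of_mem_fibre_of_regPr)
open Summit.QuantumFields.YangMills.Theorems.Prop7CritEL (isOpen_regPr continuousAt_of_differentiableAt_bonds)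
open Summit.QuantumFields.YangMills.Theorems.Prop7Growth142T3ChartELStat (hasDerivAt_wilsonAction4_of_hasDerivAt_mulStar)
open Summit.QuantumFields.YangMills.Theorems.Prop7SymAvgRelDiffT3 (hasFDerivAt_rel_of_regPr)
open Summit.QuantumFields.YangMills.Theorems.Prop7SymAvgTwGaugeDir (hasFDerivAt_logChartSym)
open Summit.QuantumFields.YangMills.Theorems.Prop7SymAvgGL (QSym)

variable (F : T3Family) {n K : ℕ} (h : n ≤ K)

/-- ★★★ **THE KNIT'S E–L CLAUSE AT EVERY GAUGE COPY FROM TANGENT-CRITICALITY OF A REGULAR CONFIGURATION.**  `U′ ∈ 𝔘_k(ε₀)` with `10⁷L³ε₀ ≤ 1`; `G′` the derivative at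
`0` of the relative `(M₂)ˣ`-average `A ↦ D̄(e^{A}U′)·D̄(U′)⁻¹`; `U′` tangent-critical («`Lin_{U′}(ξ) = 0` whenever `G′ξ = 0`», print's (82)–(83) ∕ (141)); `W = U′^u` any gauge
copy.  Then along every curve `γ` through `W` inside a fibre `𝔅_k(V)`, bondwise differentiable at `0`, the derivative of the Wilson action vanishes.
[cite: Balaban1985Variational, (82)-(83) p.290, (141) p.299, (3)-(5) p.278, (26)-(27) p.282; Balaban1985Averaging, (11) p.19] -/
theorem fibreEL_of_tangentCritical {ε₀ : ℝ} (hε₀ : 0 < ε₀) (hε : 10 ^ 7 * (F.L : ℝ) ^ 3 * ε₀ ≤ 1)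
    {V : GaugeField (F.P n) 0 (Matrix.specialUnitaryGroup (Fin 2) ℂ)} {U' W : GaugeField (F.P K) 0 (Matrix.specialUnitaryGroup (Fin 2) ℂ)}
    (hreg : RegPr F n K ε₀ U')
    {G' : (PBond (F.P K) 0 → Matrix (Fin 2) (Fin 2) ℂ) →L[ℂ] (PBond (F.P n) 0 → Matrix (Fin 2) (Fin 2) ℂ)}
    (hG : HasFDerivAt (fun A : PBond (F.P K) 0 → Matrix (Fin 2) (Fin 2) ℂ => fun c : PBond (F.P n) 0 =>
        ((descendToGL F n K h (fun b => expUnit (A b) * bgUnits F K U' b) c : (Matrix (Fin 2) (Fin 2) ℂ)ˣ) : Matrix (Fin 2) (Fin 2) ℂ) *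
          (((descendToGL F n K h (bgUnits F K U') c)⁻¹ : (Matrix (Fin 2) (Fin 2) ℂ)ˣ) : Matrix (Fin 2) (Fin 2) ℂ)) G' 0)
    (hcrit : ∀ ξ : PBond (F.P K) 0 → Matrix (Fin 2) (Fin 2) ℂ, G' ξ = 0 →
      ∑ p : Plaq (F.P K) 0, (1 / 2) * ((((((GaugeField.plaqHol U' p : Matrix.specialUnitaryGroup (Fin 2) ℂ) : Matrix (Fin 2) (Fin 2) ℂ)) - 1)ᴴ
          * ((ξ ⟨p.src, p.μ⟩
              + (U' ⟨p.src, p.μ⟩ : Matrix (Fin 2) (Fin 2) ℂ) * ξ ⟨p.src.shift p.μ, p.ν⟩ * star (U' ⟨p.src, p.μ⟩ : Matrix (Fin 2) (Fin 2) ℂ)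
              - ((U' ⟨p.src, p.μ⟩ * U' ⟨p.src.shift p.μ, p.ν⟩ * (U' ⟨p.src.shift p.ν, p.μ⟩)⁻¹ : Matrix.specialUnitaryGroup (Fin 2) ℂ) : Matrix (Fin 2) (Fin 2) ℂ)
                  * ξ ⟨p.src.shift p.ν, p.μ⟩
                  * star ((U' ⟨p.src, p.μ⟩ * U' ⟨p.src.shift p.μ, p.ν⟩ * (U' ⟨p.src.shift p.ν, p.μ⟩)⁻¹ : Matrix.specialUnitaryGroup (Fin 2) ℂ) : Matrix (Fin 2) (Fin 2) ℂ)
              - ((GaugeField.plaqHol U' p : Matrix.specialUnitaryGroup (Fin 2) ℂ) : Matrix (Fin 2) (Fin 2) ℂ) * ξ ⟨p.src, p.ν⟩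
                  * star ((GaugeField.plaqHol U' p : Matrix.specialUnitaryGroup (Fin 2) ℂ) : Matrix (Fin 2) (Fin 2) ℂ))
            * ((GaugeField.plaqHol U' p : Matrix.specialUnitaryGroup (Fin 2) ℂ) : Matrix (Fin 2) (Fin 2) ℂ))).trace).re = 0)
    (u : GaugeTransf (F.P K) 0 (Matrix.specialUnitaryGroup (Fin 2) ℂ)) (hW : W = GaugeField.gaugeAct u U') :
    ∀ γ : ℝ → GaugeField (F.P K) 0 (Matrix.specialUnitaryGroup (Fin 2) ℂ), γ 0 = W → (∀ t, γ t ∈ fibre F ℰp n K h V) →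
      (∀ b : PBond (F.P K) 0, DifferentiableAt ℝ (fun t => ((γ t b : Matrix.specialUnitaryGroup (Fin 2) ℂ) : Matrix (Fin 2) (Fin 2) ℂ)) 0) →
        deriv (fun t => wilsonAction4 (γ t)) 0 = 0 := by
  intro γ hγ0 hγfib hγdiff
  -- the inverse gauge transformation and the conjugated curve `γ̃ = γ^{u⁻¹}` through `U′`
  set ui : GaugeTransf (F.P K) 0 (Matrix.specialUnitaryGroup (Fin 2) ℂ) := fun x => (u x)⁻¹ with hui
  set γt : ℝ → GaugeField (F.P K) 0 (Matrix.specialUnitaryGroup (Fin 2) ℂ) := fun t => GaugeField.gaugeAct ui (γ t) with hγt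
  have hγt0 : γt 0 = U' := by
    funext b
    simp only [hγt, hγ0, hW, GaugeField.gaugeAct, hui]
    group
  -- gauge invariance of (5): `A ∘ γ = A ∘ γ̃`
  have hA : (fun t => wilsonAction4 (γ t)) = fun t => wilsonAction4 (γt t) :=
    funext fun t => (T4WilsonGaugeFlatDirection.wilsonAction_gaugeAct 1 ui (γ t)).symm
  -- bond coordinates of `γ̃` are differentiable at `0`
  have hγtdiff : ∀ b : PBond (F.P K) 0, DifferentiableAt ℝ (fun t => ((γt t b : Matrix.specialUnitaryGroup (Fin 2) ℂ) : Matrix (Fin 2) (Fin 2) ℂ)) 0 := by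
    intro b
    have hcoe : (fun t => ((γt t b : Matrix.specialUnitaryGroup (Fin 2) ℂ) : Matrix (Fin 2) (Fin 2) ℂ))
        = fun t => ((ui b.src : Matrix.specialUnitaryGroup (Fin 2) ℂ) : Matrix (Fin 2) (Fin 2) ℂ) * ((γ t b : Matrix.specialUnitaryGroup (Fin 2) ℂ) : Matrix (Fin 2) (Fin 2) ℂ)
            * (((ui b.tgt)⁻¹ : Matrix.specialUnitaryGroup (Fin 2) ℂ) : Matrix (Fin 2) (Fin 2) ℂ) := by
      funext t
      simp only [hγt, GaugeField.gaugeAct, Submonoid.coe_mul]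
    rw [hcoe]
    exact ((differentiableAt_const _).mul (hγdiff b)).mul (differentiableAt_const _)
  -- the bond velocities `ξ(b)` of `γ̃(t)(b)·U′(b)^*`
  set ξ : PBond (F.P K) 0 → Matrix (Fin 2) (Fin 2) ℂ := fun b =>
    deriv (fun t : ℝ => ((γt t b : Matrix.specialUnitaryGroup (Fin 2) ℂ) : Matrix (Fin 2) (Fin 2) ℂ) * star (U' b : Matrix (Fin 2) (Fin 2) ℂ)) 0 with hξ
  have hγtξ : ∀ b : PBond (F.P K) 0,
      HasDerivAt (fun t : ℝ => ((γt t b : Matrix.specialUnitaryGroup (Fin 2) ℂ) : Matrix (Fin 2) (Fin 2) ℂ) * star (U' b : Matrix (Fin 2) (Fin 2) ℂ)) (ξ b) 0 :=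
    fun b => ((hγtdiff b).mul_const _).hasDerivAt
  -- unitarity at `t = 0`: `γ̃(0)(b)·U′(b)^* = 1`
  have hone : ∀ b : PBond (F.P K) 0, ((γt 0 b : Matrix.specialUnitaryGroup (Fin 2) ℂ) : Matrix (Fin 2) (Fin 2) ℂ) * star (U' b : Matrix (Fin 2) (Fin 2) ℂ) = 1 := by
    intro b
    rw [hγt0]
    exact (Matrix.mem_unitaryGroup_iff).1 (Matrix.mem_specialUnitaryGroup_iff.1 (U' b).2).1
  -- `γ̃` is continuous at `0`, hence eventually `𝔘_k(ε₀)`-regular and bondwise within the log's radius of `U′`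
  have hcont : ∀ b : PBond (F.P K) 0, ContinuousAt (fun t => ((γt t b : Matrix.specialUnitaryGroup (Fin 2) ℂ) : Matrix (Fin 2) (Fin 2) ℂ)) 0 :=
    fun b => (hγtdiff b).continuousAt
  have hcontSU : ContinuousAt γt 0 := continuousAt_of_differentiableAt_bonds γt hγtdiff
  have hreg_ev : ∀ᶠ t in 𝓝 (0 : ℝ), RegPr F n K ε₀ (γt t) := by
    have hmem : γt 0 ∈ {U : GaugeField (F.P K) 0 (Matrix.specialUnitaryGroup (Fin 2) ℂ) | RegPr F n K ε₀ U} := by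
      rw [hγt0]; exact hreg
    exact hcontSU.preimage_mem_nhds ((isOpen_regPr F n K ε₀).mem_nhds hmem)
  have hclose_ev : ∀ᶠ t in 𝓝 (0 : ℝ), ∀ b : PBond (F.P K) 0,
      ‖((γt t b : Matrix.specialUnitaryGroup (Fin 2) ℂ) : Matrix (Fin 2) (Fin 2) ℂ) * star (U' b : Matrix (Fin 2) (Fin 2) ℂ) - 1‖ < 1 := by
    refine eventually_all.2 fun b => ?_
    have hc : ContinuousAt (fun t : ℝ => ((γt t b : Matrix.specialUnitaryGroup (Fin 2) ℂ) : Matrix (Fin 2) (Fin 2) ℂ) * star (U' b : Matrix (Fin 2) (Fin 2) ℂ)) 0 :=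
      (hcont b).mul continuousAt_const
    have ht := Metric.tendsto_nhds.1 hc 1 one_pos
    simp only [hone b] at ht
    filter_upwards [ht] with t hdt
    rwa [dist_eq_norm] at hdt
  -- `γ̃` lies in the fibre of `V^{(u⁻¹)↓}`
  have hγtfib : ∀ t, γt t ∈ fibre F ℰp n K h (GaugeField.gaugeAct (descTransf F n K h ui) V) := fun t =>
    (gaugeAct_mem_fibre_iff F h ℰp ui (γ t) V).2 (hγfib t)
  -- the log-coordinates `A(t)(b) = log(γ̃(t)(b)·U′(b)^*)`, `A(0) = 0`, `A′(0) = ξ`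
  set A : ℝ → (PBond (F.P K) 0 → Matrix (Fin 2) (Fin 2) ℂ) := fun t b =>
    mlog (((γt t b : Matrix.specialUnitaryGroup (Fin 2) ℂ) : Matrix (Fin 2) (Fin 2) ℂ) * star (U' b : Matrix (Fin 2) (Fin 2) ℂ)) with hAdef
  have hA0 : A 0 = 0 := by
    funext b
    simp only [hAdef, Pi.zero_apply]
    rw [hone b, mlog_one]
  have hAderiv : HasDerivAt A ξ 0 := by
    rw [hasDerivAt_pi]
    intro b
    have h1 : HasFDerivAt (mlog : Matrix (Fin 2) (Fin 2) ℂ → Matrix (Fin 2) (Fin 2) ℂ) (1 : Matrix (Fin 2) (Fin 2) ℂ →L[ℂ] Matrix (Fin 2) (Fin 2) ℂ)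
        (((γt 0 b : Matrix.specialUnitaryGroup (Fin 2) ℂ) : Matrix (Fin 2) (Fin 2) ℂ) * star (U' b : Matrix (Fin 2) (Fin 2) ℂ)) := by
      rw [hone b]; exact hasFDerivAt_mlog_one
    have h2 := (h1.restrictScalars ℝ).comp_hasDerivAt (0 : ℝ) (hγtξ b)
    have hfun : (fun x => A x b) = ((mlog : Matrix (Fin 2) (Fin 2) ℂ → Matrix (Fin 2) (Fin 2) ℂ) ∘
        fun t : ℝ => ((γt t b : Matrix.specialUnitaryGroup (Fin 2) ℂ) : Matrix (Fin 2) (Fin 2) ℂ) * star (U' b : Matrix (Fin 2) (Fin 2) ℂ)) := by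
      funext x; simp only [hAdef, Function.comp_apply]
    rw [hfun]
    simpa using h2
  -- along `A` the relative average is EVENTUALLY `1` (covariance of the averages + regularity): so its derivative at `0` is `0`
  have hΨ_ev : ∀ᶠ t in 𝓝 (0 : ℝ), (fun c : PBond (F.P n) 0 =>
      ((descendToGL F n K h (fun b => expUnit (A t b) * bgUnits F K U' b) c : (Matrix (Fin 2) (Fin 2) ℂ)ˣ) : Matrix (Fin 2) (Fin 2) ℂ) *
        (((descendToGL F n K h (bgUnits F K U') c)⁻¹ : (Matrix (Fin 2) (Fin 2) ℂ)ˣ) : Matrix (Fin 2) (Fin 2) ℂ))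
      = fun _ => (1 : Matrix (Fin 2) (Fin 2) ℂ) := by
    filter_upwards [hreg_ev, hclose_ev] with t hregt hcloset
    -- `e^{A(t)}·U′♭ = γ̃(t)♭`
    have hcfg : (fun b => expUnit (A t b) * bgUnits F K U' b) = bgUnits F K (γt t) := by
      funext b
      apply Units.ext
      have hU : star (U' b : Matrix (Fin 2) (Fin 2) ℂ) * (U' b : Matrix (Fin 2) (Fin 2) ℂ) = 1 :=
        (Matrix.mem_unitaryGroup_iff').1 (Matrix.mem_specialUnitaryGroup_iff.1 (U' b).2).1
      rw [Units.val_mul, val_expUnit]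
      show exp (mlog (((γt t b : Matrix.specialUnitaryGroup (Fin 2) ℂ) : Matrix (Fin 2) (Fin 2) ℂ) * star (U' b : Matrix (Fin 2) (Fin 2) ℂ)))
          * ((U' b : Matrix.specialUnitaryGroup (Fin 2) ℂ) : Matrix (Fin 2) (Fin 2) ℂ) = ((γt t b : Matrix.specialUnitaryGroup (Fin 2) ℂ) : Matrix (Fin 2) (Fin 2) ℂ)
      rw [exp_mlog (hcloset b), mul_assoc, hU, mul_one]
    have h1 := descendToGL_eq_of_mem_fibre_of_regPr F h hε₀ hε (hγtfib t) hregt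
    have h2 := descendToGL_eq_of_mem_fibre_of_regPr F h hε₀ hε (hγtfib 0) (by rw [hγt0]; exact hreg)
    rw [hγt0] at h2
    funext c
    rw [hcfg, show bgUnits F K (γt t) = unitsField (toUField (γt t)) from rfl, h1, show bgUnits F K U' = unitsField (toUField U') from rfl, h2,
      Units.mul_inv]
  have hD0 : HasDerivAt (fun t : ℝ => fun c : PBond (F.P n) 0 =>
      ((descendToGL F n K h (fun b => expUnit (A t b) * bgUnits F K U' b) c : (Matrix (Fin 2) (Fin 2) ℂ)ˣ) : Matrix (Fin 2) (Fin 2) ℂ) *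
        (((descendToGL F n K h (bgUnits F K U') c)⁻¹ : (Matrix (Fin 2) (Fin 2) ℂ)ˣ) : Matrix (Fin 2) (Fin 2) ℂ)) 0 0 :=
    (hasDerivAt_const (0 : ℝ) (fun _ : PBond (F.P n) 0 => (1 : Matrix (Fin 2) (Fin 2) ℂ))).congr_of_eventuallyEq hΨ_ev
  -- … and by the chain rule it is `G′ξ`
  have hDG : HasDerivAt (fun t : ℝ => fun c : PBond (F.P n) 0 =>
      ((descendToGL F n K h (fun b => expUnit (A t b) * bgUnits F K U' b) c : (Matrix (Fin 2) (Fin 2) ℂ)ˣ) : Matrix (Fin 2) (Fin 2) ℂ) *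
        (((descendToGL F n K h (bgUnits F K U') c)⁻¹ : (Matrix (Fin 2) (Fin 2) ℂ)ˣ) : Matrix (Fin 2) (Fin 2) ℂ)) (G' ξ) 0 := by
    have hG0 : HasFDerivAt (fun A : PBond (F.P K) 0 → Matrix (Fin 2) (Fin 2) ℂ => fun c : PBond (F.P n) 0 =>
        ((descendToGL F n K h (fun b => expUnit (A b) * bgUnits F K U' b) c : (Matrix (Fin 2) (Fin 2) ℂ)ˣ) : Matrix (Fin 2) (Fin 2) ℂ) *
          (((descendToGL F n K h (bgUnits F K U') c)⁻¹ : (Matrix (Fin 2) (Fin 2) ℂ)ˣ) : Matrix (Fin 2) (Fin 2) ℂ)) (G'.restrictScalars ℝ) (A 0) := by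
      rw [hA0]; exact hG.restrictScalars ℝ
    have h2 := hG0.comp_hasDerivAt (0 : ℝ) hAderiv
    have h3 : (G'.restrictScalars ℝ) ξ = G' ξ := rfl
    rw [h3] at h2
    exact h2
  have hGξ : G' ξ = 0 := hDG.unique hD0
  -- tangent-criticality and «`Lin` is the derivative»
  have hLin := hcrit ξ hGξ
  have hderiv := hasDerivAt_wilsonAction4_of_hasDerivAt_mulStar U' γt hγt0 ξ hγtξ
  rw [hA, hderiv.deriv]
  exact hLin

/-! ## §2 The same with the tangent space read through print's `QSym(U′)` — `hG` discharged at printed-regular backgrounds -/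

/-- ★★★ **THE KNIT'S E–L CLAUSE AT EVERY GAUGE COPY FROM (141) IN `QSym`-LETTERS.**  At a printed-regular `U′ ∈ 𝔘_k(ε₀)`, `10⁷L³ε₀ ≤ 1`, the relative average is
differentiable (✓`Prop7SymAvgRelDiffT3.hasFDerivAt_rel_of_regPr`) and its derivative is print's symmetric linearised average `QSym(U′)` (✓`hasFDerivAt_logChartSym`); so if
`Lin_{U′}(ξ) = 0` for every `ξ ∈ ker QSym(U′)` (the tangent form (82)–(83) ∕ (141) at the chart point), then every gauge copy `W = U′^u` satisfies the knit's E–L clause along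
every bondwise-differentiable curve in a fibre `𝔅_k(V)` through `W`. [cite: Balaban1985Variational, (82)-(83) p.290, (141) p.299, (44) p.285, (3)-(5) p.278; Balaban1985Averaging, (11) p.19] -/
theorem fibreEL_of_tangentCritical_QSym {ε₀ : ℝ} (hε₀ : 0 < ε₀) (hε : 10 ^ 7 * (F.L : ℝ) ^ 3 * ε₀ ≤ 1)
    {V : GaugeField (F.P n) 0 (Matrix.specialUnitaryGroup (Fin 2) ℂ)} {U' W : GaugeField (F.P K) 0 (Matrix.specialUnitaryGroup (Fin 2) ℂ)}
    (hreg : RegPr F n K ε₀ U')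
    (hcrit : ∀ ξ : PBond (F.P K) 0 → Matrix (Fin 2) (Fin 2) ℂ, QSym F n K h U' ξ = 0 →
      ∑ p : Plaq (F.P K) 0, (1 / 2) * ((((((GaugeField.plaqHol U' p : Matrix.specialUnitaryGroup (Fin 2) ℂ) : Matrix (Fin 2) (Fin 2) ℂ)) - 1)ᴴ
          * ((ξ ⟨p.src, p.μ⟩
              + (U' ⟨p.src, p.μ⟩ : Matrix (Fin 2) (Fin 2) ℂ) * ξ ⟨p.src.shift p.μ, p.ν⟩ * star (U' ⟨p.src, p.μ⟩ : Matrix (Fin 2) (Fin 2) ℂ)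
              - ((U' ⟨p.src, p.μ⟩ * U' ⟨p.src.shift p.μ, p.ν⟩ * (U' ⟨p.src.shift p.ν, p.μ⟩)⁻¹ : Matrix.specialUnitaryGroup (Fin 2) ℂ) : Matrix (Fin 2) (Fin 2) ℂ)
                  * ξ ⟨p.src.shift p.ν, p.μ⟩
                  * star ((U' ⟨p.src, p.μ⟩ * U' ⟨p.src.shift p.μ, p.ν⟩ * (U' ⟨p.src.shift p.ν, p.μ⟩)⁻¹ : Matrix.specialUnitaryGroup (Fin 2) ℂ) : Matrix (Fin 2) (Fin 2) ℂ)
              - ((GaugeField.plaqHol U' p : Matrix.specialUnitaryGroup (Fin 2) ℂ) : Matrix (Fin 2) (Fin 2) ℂ) * ξ ⟨p.src, p.ν⟩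
                  * star ((GaugeField.plaqHol U' p : Matrix.specialUnitaryGroup (Fin 2) ℂ) : Matrix (Fin 2) (Fin 2) ℂ))
            * ((GaugeField.plaqHol U' p : Matrix.specialUnitaryGroup (Fin 2) ℂ) : Matrix (Fin 2) (Fin 2) ℂ))).trace).re = 0)
    (u : GaugeTransf (F.P K) 0 (Matrix.specialUnitaryGroup (Fin 2) ℂ)) (hW : W = GaugeField.gaugeAct u U') :
    ∀ γ : ℝ → GaugeField (F.P K) 0 (Matrix.specialUnitaryGroup (Fin 2) ℂ), γ 0 = W → (∀ t, γ t ∈ fibre F ℰp n K h V) →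
      (∀ b : PBond (F.P K) 0, DifferentiableAt ℝ (fun t => ((γ t b : Matrix.specialUnitaryGroup (Fin 2) ℂ) : Matrix (Fin 2) (Fin 2) ℂ)) 0) →
        deriv (fun t => wilsonAction4 (γ t)) 0 = 0 := by
  have hGrel := hasFDerivAt_rel_of_regPr F h hε₀ hε U' hreg
  have hQ : QSym F n K h U' = fderiv ℂ (fun A : PBond (F.P K) 0 → Matrix (Fin 2) (Fin 2) ℂ => fun c : PBond (F.P n) 0 =>
        ((descendToGL F n K h (fun b => expUnit (A b) * bgUnits F K U' b) c : (Matrix (Fin 2) (Fin 2) ℂ)ˣ) : Matrix (Fin 2) (Fin 2) ℂ)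
          * (((descendToGL F n K h (bgUnits F K U') c)⁻¹ : (Matrix (Fin 2) (Fin 2) ℂ)ˣ) : Matrix (Fin 2) (Fin 2) ℂ)) 0 :=
    (hasFDerivAt_logChartSym F h U' hGrel).fderiv
  exact fibreEL_of_tangentCritical F h hε₀ hε hreg hGrel (fun ξ hξ => hcrit ξ (by rw [hQ]; exact hξ)) u hW

end Summit.QuantumFields.YangMills.Theorems.Prop7FibreELOfTangentCritical

end
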